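import Literature.NumberTheory.EllipticCurves.ManinConstantKodairaTypePrimes
import Summits.BirchSwinnertonDyer.Rank1Residual.ManinAdditive.PlusIndexLaws
import HarnessLib
import HarnessLib.Audit.Tags

/-!
# THE LOCAL DIFFERENTIAL LAW OF THE TWO 3-ISOGENIES OUT OF A HESSE CURVE AT `p = 3`
# (cell `bsd-f2-manin`, planner an g41; laws E-an-227 / E-an-228 (pull-back constants), E-an-229 (Kodaira menu),
# E-an-230R / E-an-230M (Kodaira symbols of the quotients); answer to ref1 §R195 «E-an-224 (a) — please TYPE it»)

LENS an (Néron lattices `Λ_W ⊂ ℂ` of minimal models; isogeny-class bookkeeping) × the cell's SEARCH QUESTION at `p = 3`.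
A **Hesse curve** `E_H/ℚ` has `E_H[3] ≅ ℤ/3 ⊕ μ₃`: a rational point `T` of order `3` (`IsShortThreeTorsion`) AND `μ₃ ⊂ E_H`
(`HasShortMuThree`).  Its two rational `3`-isogenies are `E_H → M := E_H/⟨T⟩` and `E_H → P := E_H/μ₃`.  For an isogeny
`π : W → W'` between GLOBALLY MINIMAL models the **pull-back constant** `a = a(π) ∈ ℤ` is `π^*ω_{W'} = a·ω_W`; analytically
`π` is `z ↦ a·z : ℂ/Λ_W → ℂ/Λ_{W'}` (`a·Λ_W ⊆ Λ_{W'}`), its kernel is `a⁻¹Λ_{W'}/Λ_W`, and for `deg π = 3` one has `a·â = 3`,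
`a ∈ {±1, ±3}`; `a = ±3 ⟺ Λ_{W'} ⊂ Λ_W` (index 3, the quotient LOWERS the Faltings height by `½ log 3`), `a = ±1 ⟺ Λ_W ⊂ Λ_{W'}`.
This file types the kernel ANALYTICALLY (no algebraic isogeny object, no modularity, no `ModularParametrizationData`):
`IsLatticeIsogenyWithKernelAbscissa L L' c a X` says `a·Λ ⊆ Λ'`, the kernel is non-trivial, and every kernel element `z ∉ Λ`
has short-model abscissa `c²·℘_Λ(z) = X` (the abscissa of `E_{W,c}`, `X = c²(x + b₂/12) = c²℘(z)`, cf. `shortRoot`,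
`uniformize_spec`); `L, L'` are tied to `W, W'` by `IsNeronLatticeOf` (`g₂ = c₄/12`, `g₃ = c₆/216`: THE Néron lattice of the
globally minimal model); with `X = X₀ = x(T)` the kernel is `⟨T⟩ = {0, ±T}`, with `X = X₁` a `μ₃`-abscissa it is the `μ₃`-line.
In the cell one applies the laws with `L := D.L`, `c := D.c` (`D.isNeronLattice`), `D : ModularParametrizationData W N`.

## THE LAW (census: Cremona `allisog` × `alldegphi` × `opt_man`, ALL 2 315 Hesse curves with `N ≤ 499 710`, 4 630 pairs; `a` read
## off `q = deg/c²` (`q(W')/q(W) = 3/a²`); Kodaira symbols by Tate's algorithm (ref1 e195 `tate17`); an g41 `hesse227-an-g41.py`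
## 4a5e8c975fb26163 → `hesse227-out-an-g41.txt` 4bc7274f1969aaff; 0 exceptions)

  v₃(N) | Kod₃(E_H) (count)        | M = E_H/⟨T⟩ : a, Kod₃(M)      | P = E_H/μ₃ : a, Kod₃(P)
  ------+--------------------------+-------------------------------+---------------------------
    0   | I₀ (837)                 | a = 1, I₀                     | a = 3, I₀
    1   | I₃ₖ (459; k = 1…6)       | a = 1, Iₖ                     | a = 3, I₉ₖ
    2   | I₀* (256), I₃ₖ* (255)    | a = 3, I₀* / I₉ₖ*             | a = 1, I₀* / Iₖ*
   ≥ 3  | II (254)                 | a = 1, IV*  (253; +1 Hesse)   | a = 1, IV   (254)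
   ≥ 3  | IV* (254)                | a = 1, II*  (254)             | a = 3, II   (253; +1 Hesse)

So **`a(E_H → E_H/⟨T⟩) = 3 ⟺ Kod₃(E_H) ∈ {I₀*, Iₙ*}`** (E-an-227) and **`a(E_H → E_H/μ₃) = 1 ⟺ Kod₃(E_H) ∈ {I₀*, Iₙ*, II}`**
(E-an-228): the `μ₃`-quotient lowers the height except at TAME ADDITIVE `3` (where the ramified quadratic twist by `ℚ₃(√−3)`
swaps the two lines: the rational line of `E_H` is the twist of the CONNECTED line of the semistable twist) and at type II
(where nothing lowers).

## PLACEMENT IN PRINT (this is what the an lens adds to ref1's census law; queries: `lit search "Dokchitser local invariants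
## isogenous elliptic curves"` → [corpus:paper:arxiv-1208.5519 p3 (Table 1), p4, p7]; `lit read paper:arxiv-1703.02148` → [corpus:
## paper:arxiv-1703.02148 p3 Thm 1]; galaxy not needed (both held))
* Rows `v₃(N) ≤ 2` are PRINTED-DERIVABLE from [DokchitserDokchitser2015 = arXiv:1208.5519, Table 1 and its (†)]: for an `ℓ = p`
  isogeny with good ordinary / multiplicative / additive potentially multiplicative / additive potentially good ORDINARY source,
  `φ^*ω'/ω = p` (up to a unit) iff `ker φ ⊂ Ê(𝔪_L)` over a field where the source acquires good or split multiplicative reduction,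
  else `1`.  At `p = 3`: the `μ₃`-line lies in the formal group in rows 0–1 (ordinary good / Tate curve: `ζ₃ ≡ 1 (mod 𝔪)`), the
  `ℤ/3`-line does in row 2 (over `ℚ₃(√−3)` the Hesse curve of type `I₀*`/`Iₙ*` is the twist by `ω = χ₋₃` of a semistable curve
  whose connected line has character `ω`; twisting by `ω` makes THAT line the rational one).  The quotient symbols `Iₖ ↔ I₉ₖ`,
  `Iₖ* ↔ I₉ₖ*` are DD's `v(j') = p^{±1}·v(j)` columns.
* Rows `v₃(N) ≥ 3` (additive potentially supersingular, `K = ℚ₃` unramified): [arXiv:1703.02148, Thm. 1] `a = p ⟺ m(E) > m(E')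
  ⟺ v(Δ_min E) > v(Δ_min E')` (`m` = number of components of the special fibre of the minimal regular model; `m(E) ≠ m(E')`
  always).  Checked on all 1 016 wild pairs: 0 violations (the census engine and the printed theorem validate each other).
  Hence from type II (`m = 1`, minimal) EVERY 3-isogeny has `a = 1` — printed-derivable; from type IV* (`m = 7`) the theorem
  gives `a = 3 ⟺ m(E') < 7`, and the census supplies the RESIDUAL, beyond-print content **E-an-230: `E_H` of type IV* ⟹
  `E_H/⟨T⟩` is of type II* (`m = 9`) and `E_H/μ₃` of type II (`m = 1`); `E_H` of type II ⟹ `E_H/⟨T⟩` is IV*, `E_H/μ₃` is IV`**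
  (1 014 / 1 014 + the two Hesse–Hesse pairs `27a3 → 27a1`, `27a1 → 27a3`).
* Consequence for the cell (E-an-224, MEMO-an §85; ref1 §R195 (b)): Stevens' minimal-height member `E₁` of a Hesse class is
  `P` for `v₃(N) ≤ 1`, `M` for `v₃(N) = 2`, `E_H` in the Kodaira-II half and `P` in the IV* half of `v₃(N) ≥ 3` — the FLIP of
  the optimal member between `3 ∥ N` and `9 ∥ N` (an's E-an-223/224 census) is the printed (†)-criterion read through the
  `χ₋₃`-twist.  Nothing here uses optimality or modularity (period lattices + Tate's algorithm only).

TYPER FRAMING: lens an; E-an-227/228 rows 0–2 and the II-half of row ≥ 3 are THEOREMS ON PAPER (DD 2015 Table 1 (†) +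
arXiv:1703.02148 Thm 1 + the twist bookkeeping above), typed as LAWS (the tree has no Néron-model / formal-group API for the
kernel); E-an-229 (menu) and E-an-230 (quotient symbols at IV*/II) are CENSUS LAWS (2 315 / 2 315 and 1 016 / 1 016).  BC5 = the
table above.  BC7 (`#h21_crux_probe`, HOME/an/g41/Probe-bc7-D-g41.lean, `lean check --no-snap`, route-BirchSwinnertonDyer-
ManinLocalTwoThree): 5 / 5 CLEAN (fired [] on all five laws, 0 battery timeouts).  Cheapest falsifier: one Hesse curve with `N ≤ 5·10⁵` violating a row (run: 0 / 4 630).  PARTITION 0 (no kit; one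
48 s local scan over ecdata with ref1's engine) · beyond-print theorem: NO (laws; placement yes) · BSD is not proved by this;
Manin's conjecture, C2, C3 are not touched by this file.

TYPER NOTE (typer g21, T-an-56).  SOURCE = HOME/an/g41/HesseIsogenyDifferentialAtThree-an-g41.lean (FILE D) sha16 7d24c36082f3008c (243 l.; an:
farm rc 0 · 0 err · 0 warn · 0 sorry; BC7 5/5 CLEAN Probe-bc7-D-g41.lean 08a95dd89afcd104; MEMO-an §86.9, HOME/an/MEMO-an-86.md 8394303ccebbc04d;
census hesse227-an-g41.py 4a5e8c975fb26163 → hesse227-out-an-g41.txt 4bc7274f1969aaff) VERBATIM — an's header above, every body/docstring below;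
the only typer delta is this note.  Imports: landed `Literature…ManinConstantKodairaTypePrimes` + `…ManinAdditive.PlusIndexLaws` (Theses-free)
+ HarnessLib(+Audit.Tags) — route-independent; namespace `…ManinAdditive.HesseIsogenyDifferential`.  Note: `placeThree` here is a verbatim twin
(same body, `rfl`-equal) of `…ManinAdditive.NeronOmegaThree.placeThree` — kept as an wrote it to avoid importing the Ω₃ file; bridge by `rfl` if
ever needed.  CONTENT: defs `placeThree`, `kodairaAtThree`, `IsIstarAtThree`, `IsShortMuThreeAbscissa` (+ PROVED `hasShortMuThree_iff_exists_abscissa`),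
`IsLatticeIsogenyWithKernelAbscissa` (analytic typing of a 3-isogeny with prescribed kernel abscissa; no algebraic isogeny object, no modularity);
ROWS (an's `@[conjecture]` tags, nothing asserted): **E-an-227 `HesseRationalKernelDifferentialLaw`**, **E-an-228 `HesseMuKernelDifferentialLaw`**
(pull-back constants a² ∈ {1, 9} by Kodaira type at 3; rows v₃(N) ≤ 2 and the II-half printed-derivable from [DokchitserDokchitser2015LocalInvariants]
Table 1 (†) and arXiv:1703.02148 Thm 1, typed as LAWS for want of a Néron-model/formal-group kernel API), **E-an-229 `HesseKodairaMenuAtThree`**,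
**E-an-230R `HesseRationalQuotientKodairaAtThree`**, **E-an-230M `HesseMuQuotientKodairaAtThree`** (census laws 2 315/2 315 Hesse curves, 4 630
pairs, N ≤ 499 710, 0 exceptions; second engine D-an-27 asked); PROVED bookkeeping `mu_lowers_rational_raises_of_laws`, `rational_lowers_at_Istar_of_laws`
(the 9 ∥ N flip), `nothing_lowers_at_II_of_laws`.  REFUTER: ref1 R-an-81 PENDING at landing (§R195 asked for this typing).  Typer checks: 14 decl
names fresh as FQNs; no instances, no notation, no sorry; no `[cite:]` keys needed (Summits side).  `--supports` refused for ManinAdditive ⇒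
bears_on: stmt-BirchSwinnertonDyer-22968 (C3 `ManinPrimeToThreeAtNine`).  PARTITION 0 · beyond-print theorem: no · BSD is not proved by this;
Manin `c = 1` is not proved by this; C3 OPEN.
-/

noncomputable section

open scoped Classical

open Complex WeierstrassCurve Literature.NumberTheory.EllipticCurves Literature.NumberTheory.EllipticCurves.ModularForms
  Literature.NumberTheory.DiophantineGeometry

namespace Summit.BirchSwinnertonDyer.Rank1Residual.ManinAdditive.HesseIsogenyDifferential

open Summit.BirchSwinnertonDyer.Rank1Residual.ManinAdditive.KatoCurve
  Summit.BirchSwinnertonDyer.Rank1Residual.ManinAdditive.CuspidalKummer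
  Summit.BirchSwinnertonDyer.Rank1Residual.ManinAdditive.CuspidalKummerThree

/-! ### §0. Vocabulary -/

/-- The finite place `(3)` of `ℤ` (Mathlib's `Rat.HeightOneSpectrum.primesEquiv`, as in the tree's Edixhoven Kodaira fact). -/
def placeThree : IsDedekindDomain.HeightOneSpectrum ℤ :=
  (Rat.HeightOneSpectrum.primesEquiv (R := ℤ)).symm ⟨3, Nat.prime_three⟩

/-- The Kodaira symbol of `W/ℚ` at `3` (Tate's algorithm at the place `(3)`, `WeierstrassCurve.kodairaSymbolAt`; model-independent). -/
def kodairaAtThree (W : WeierstrassCurve ℚ) : KodairaSymbol := W.kodairaSymbolAt placeThree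

/-- `Kod₃(W)` is of type `Iₙ*` for some `n ≥ 0` (additive, potentially multiplicative or `I₀*`; at a Hesse curve: `v₃(N) = 2`). -/
def IsIstarAtThree (W : WeierstrassCurve ℚ) : Prop := ∃ n : ℕ, kodairaAtThree W = .Istar n

/-- `X₁ ∈ ℚ` is a **`μ₃`-abscissa** of the short model `E_{W,c}`: a root of `Ψ₃` over which the two points `(X₁, ±√(−3)·T₁)`,
`T₁ ∈ ℚˣ`, generate a subgroup Galois-isomorphic to `μ₃` (the witness abscissa of `HasShortMuThree W c`). -/
def IsShortMuThreeAbscissa (W : WeierstrassCurve ℚ) (c : ℤ) (X₁ : ℚ) : Prop :=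
  ∃ T₁ : ℚ, (shortModel W c).Ψ₃.IsRoot X₁ ∧ T₁ ≠ 0 ∧
    X₁ ^ 3 + (shortModel W c).a₄ * X₁ + (shortModel W c).a₆ = -3 * T₁ ^ 2

/-- `HasShortMuThree W c ↔ ∃ X₁, IsShortMuThreeAbscissa W c X₁` (definitional repackaging). -/
theorem hasShortMuThree_iff_exists_abscissa (W : WeierstrassCurve ℚ) (c : ℤ) :
    HasShortMuThree W c ↔ ∃ X₁, IsShortMuThreeAbscissa W c X₁ := by
  constructor
  · rintro ⟨X₁, T₁, h₁, h₂, h₃⟩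
    exact ⟨X₁, T₁, h₁, h₂, h₃⟩
  · rintro ⟨X₁, T₁, h₁, h₂, h₃⟩
    exact ⟨X₁, T₁, h₁, h₂, h₃⟩

/-- **The analytic `3`-isogeny `z ↦ a·z : ℂ/Λ → ℂ/Λ'` with kernel the line of abscissa `X` on `E_{W,c}`.**  `Λ = L.lattice`,
`Λ' = L'.lattice` are meant to be the Néron lattices of two globally minimal models `W, W'` (`IsNeronLatticeOf`, supplied as
separate hypotheses in the laws; in the cell `L = D.L`, `c = D.c` from a `ModularParametrizationData`, by `D.isNeronLattice`);
the three clauses say: `a·Λ ⊆ Λ'` (so `z ↦ a z` descends to a homomorphism `ℂ/Λ → ℂ/Λ'`, i.e. `W(ℂ) → W'(ℂ)`), its kernel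
`a⁻¹Λ'/Λ` is non-trivial, and every non-zero kernel element has abscissa `c²·℘_Λ(z) = X` on the short model `E_{W,c}`
(`X = c²(x + b₂/12)`, `x = ℘_Λ(z) − b₂/12`, the dictionary of `shortRoot` / `uniformize_spec`).  When `X` is the abscissa of a
point `T` of order `3` (so `T ∉ E[2]` and `℘` takes the value `X/c²` exactly at `±T`), the kernel is `{0, ±T}`,
`Λ' = a·(Λ + ℤ·T̃)` is `ℚˣ`-homothetic to the lattice of `W/⟨T⟩`, hence `W' ≅_ℚ W/⟨T⟩`, and for globally minimal `W, W'` the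
integer `a` is, up to sign, the pull-back constant `π^*ω_{W'} = ±a·ω_W` of the quotient isogeny `π`. -/
def IsLatticeIsogenyWithKernelAbscissa (L L' : PeriodPair) (c a : ℤ) (X : ℚ) : Prop :=
  (∀ z ∈ L.lattice, (a : ℂ) * z ∈ L'.lattice) ∧
  (∃ z : ℂ, z ∉ L.lattice ∧ (a : ℂ) * z ∈ L'.lattice) ∧
  (∀ z : ℂ, z ∉ L.lattice → (a : ℂ) * z ∈ L'.lattice → ((c : ℂ) ^ 2) * L.weierstrassP z = (X : ℂ))

/-! ### §1. The pull-back laws E-an-227 / E-an-228 (ref1 §R195 (a), typed) -/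

/-- **E-an-227 (RATIONAL-KERNEL DIFFERENTIAL LAW AT 3).**  `W` a globally minimal Hesse curve (`T = (X₀, Y₀)` rational of order
`3` on `E_{W,c}`, and `μ₃ ⊂ W`), `W'` globally minimal, `z ↦ a z` the analytic isogeny `W → W'` with kernel `⟨T⟩`.  Then
`a = ±3` (the quotient `W/⟨T⟩` has the SMALLER Néron lattice, lower Faltings height) **iff `Kod₃(W)` is of type `Iₙ*`** (`n ≥ 0`),
and `a = ±1` otherwise.  Rows `I₀, Iₙ, Iₙ*` printed-derivable [DokchitserDokchitser2015 Table 1 (†)], row II printed-derivable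
[arXiv:1703.02148 Thm 1], row IV* = census (254 / 254).  BC5: 2 315 / 2 315 Hesse curves, `N ≤ 499 710`.
[conjecture — cell law; THEOREM ON PAPER off the IV* row, NOT a tree fact] -/
@[conjecture]
def HesseRationalKernelDifferentialLaw : Prop :=
  ∀ (W W' : WeierstrassCurve ℚ) [W.IsElliptic] [W.IsGloballyMinimal] [W'.IsElliptic] [W'.IsGloballyMinimal]
    (L L' : PeriodPair) (c : ℤ) (X₀ Y₀ : ℚ) (a : ℤ),
    IsNeronLatticeOf (W.baseChange ℂ) L → IsNeronLatticeOf (W'.baseChange ℂ) L' →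
    IsShortThreeTorsion W c X₀ Y₀ → HasShortMuThree W c → IsLatticeIsogenyWithKernelAbscissa L L' c a X₀ →
    (IsIstarAtThree W → a ^ 2 = 9) ∧ (¬ IsIstarAtThree W → a ^ 2 = 1)

/-- **E-an-228 (`μ₃`-KERNEL DIFFERENTIAL LAW AT 3).**  Same `W` (Hesse, globally minimal), `W'` globally minimal, `z ↦ a z` the
analytic isogeny `W → W'` whose kernel is the `μ₃`-line (abscissa `X₁`).  Then `a = ±1` **iff `Kod₃(W)` is of type `Iₙ*` or of
type II**, and `a = ±3` (the `μ₃`-quotient lowers the height) otherwise — i.e. at `I₀`, `Iₙ` and IV*.  Rows `I₀, Iₙ, Iₙ*` printed-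
derivable [DokchitserDokchitser2015 Table 1 (†)], row II [arXiv:1703.02148 Thm 1], row IV* = census (254 / 254).
[conjecture — cell law; THEOREM ON PAPER off the IV* row, NOT a tree fact] -/
@[conjecture]
def HesseMuKernelDifferentialLaw : Prop :=
  ∀ (W W' : WeierstrassCurve ℚ) [W.IsElliptic] [W.IsGloballyMinimal] [W'.IsElliptic] [W'.IsGloballyMinimal]
    (L L' : PeriodPair) (c : ℤ) (X₀ Y₀ X₁ : ℚ) (a : ℤ),
    IsNeronLatticeOf (W.baseChange ℂ) L → IsNeronLatticeOf (W'.baseChange ℂ) L' →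
    IsShortThreeTorsion W c X₀ Y₀ → IsShortMuThreeAbscissa W c X₁ → IsLatticeIsogenyWithKernelAbscissa L L' c a X₁ →
    ((IsIstarAtThree W ∨ kodairaAtThree W = .II) → a ^ 2 = 1) ∧
    (¬ (IsIstarAtThree W ∨ kodairaAtThree W = .II) → a ^ 2 = 9)

/-! ### §2. The Kodaira menu of a Hesse curve at 3 (E-an-229) and the symbols of its quotients (E-an-230R / E-an-230M) -/

/-- **E-an-229 (HESSE KODAIRA MENU AT 3).**  A Hesse curve has `Kod₃ ∈ {Iₙ (n ≥ 0), Iₙ* (n ≥ 0), II, IV*}` — never III, IV,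
III*, II* (census 2 315 / 2 315: I₀ 837 · I₃ₖ 459 · I₀* 256 · I₃ₖ* 255 · II 254 · IV* 254; moreover `3 ∣ n` in the `Iₙ`, `Iₙ*`
rows with `n ≥ 1`, not claimed here).  `c` is any non-zero scaling of the short model.  [conjecture — census law, NOT a tree fact] -/
@[conjecture]
def HesseKodairaMenuAtThree : Prop :=
  ∀ (W : WeierstrassCurve ℚ) [W.IsElliptic] (c : ℤ), c ≠ 0 →
    (∃ X₀ Y₀ : ℚ, IsShortThreeTorsion W c X₀ Y₀) → HasShortMuThree W c →
    (∃ n, kodairaAtThree W = .I n) ∨ IsIstarAtThree W ∨ kodairaAtThree W = .II ∨ kodairaAtThree W = .IVstar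

/-- **E-an-230R (KODAIRA SYMBOL OF THE RATIONAL-KERNEL QUOTIENT AT 3).**  For the quotient `W' ≅ W/⟨T⟩` of a Hesse curve:
`I₃ₖ ↦ Iₖ` (and `3 ∣ n`), `Iₙ* ↦ I₃ₙ*`, `II ↦ IV*`, `IV* ↦ II*`, `I₀ ↦ I₀`.  Rows `Iₙ`, `Iₙ*` are DD's `v(j)`-columns (printed-
derivable); rows II/IV* are the census residual that [arXiv:1703.02148 Thm 1] does not decide (507 / 507 + `27a3 → 27a1`).
[conjecture — cell law, NOT a tree fact] -/
@[conjecture]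
def HesseRationalQuotientKodairaAtThree : Prop :=
  ∀ (W W' : WeierstrassCurve ℚ) [W.IsElliptic] [W.IsGloballyMinimal] [W'.IsElliptic] [W'.IsGloballyMinimal]
    (L L' : PeriodPair) (c : ℤ) (X₀ Y₀ : ℚ) (a : ℤ),
    IsNeronLatticeOf (W.baseChange ℂ) L → IsNeronLatticeOf (W'.baseChange ℂ) L' →
    IsShortThreeTorsion W c X₀ Y₀ → HasShortMuThree W c → IsLatticeIsogenyWithKernelAbscissa L L' c a X₀ →
    (∀ n, kodairaAtThree W = .I n → 3 ∣ n ∧ kodairaAtThree W' = .I (n / 3)) ∧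
    (∀ n, kodairaAtThree W = .Istar n → kodairaAtThree W' = .Istar (3 * n)) ∧
    (kodairaAtThree W = .II → kodairaAtThree W' = .IVstar) ∧
    (kodairaAtThree W = .IVstar → kodairaAtThree W' = .IIstar)

/-- **E-an-230M (KODAIRA SYMBOL OF THE `μ₃`-KERNEL QUOTIENT AT 3).**  For the quotient `W' ≅ W/μ₃` of a Hesse curve:
`Iₙ ↦ I₃ₙ`, `I₃ₖ* ↦ Iₖ*` (and `3 ∣ n` for `Iₙ*`, `n ≥ 1`), `I₀* ↦ I₀*`, `II ↦ IV`, `IV* ↦ II`.  Rows `Iₙ`, `Iₙ*` printed-derivable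
(DD's `v(j)`-columns); rows II/IV* census (507 / 507 + `27a1 → 27a3`).  [conjecture — cell law, NOT a tree fact] -/
@[conjecture]
def HesseMuQuotientKodairaAtThree : Prop :=
  ∀ (W W' : WeierstrassCurve ℚ) [W.IsElliptic] [W.IsGloballyMinimal] [W'.IsElliptic] [W'.IsGloballyMinimal]
    (L L' : PeriodPair) (c : ℤ) (X₀ Y₀ X₁ : ℚ) (a : ℤ),
    IsNeronLatticeOf (W.baseChange ℂ) L → IsNeronLatticeOf (W'.baseChange ℂ) L' →
    IsShortThreeTorsion W c X₀ Y₀ → IsShortMuThreeAbscissa W c X₁ → IsLatticeIsogenyWithKernelAbscissa L L' c a X₁ →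
    (∀ n, kodairaAtThree W = .I n → kodairaAtThree W' = .I (3 * n)) ∧
    (∀ n, kodairaAtThree W = .Istar n → 3 ∣ n ∧ kodairaAtThree W' = .Istar (n / 3)) ∧
    (kodairaAtThree W = .II → kodairaAtThree W' = .IV) ∧
    (kodairaAtThree W = .IVstar → kodairaAtThree W' = .II)

/-! ### §3. PROVED bookkeeping: the three regimes of the law as the cell states them (E-an-224: «exactly one of the two
quotients lowers, and WHICH one flips at tame additive 3; at type II nothing lowers»).  The quotient-symbol laws E-an-230
imply E-an-227/228 on the wild rows through [arXiv:1703.02148 Thm 1] only ON PAPER (no component count `m` in the tree). -/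

/-- **E-an-227 on the rows `I₀, Iₙ, IV*` and E-an-228 there say the same thing as «exactly one of the two quotients lowers»:**
under E-an-227 ∧ E-an-228, at a Hesse curve NOT of type `Iₙ*` and NOT of type II the rational-kernel isogeny has `a² = 1` and the
`μ₃`-kernel isogeny has `a² = 9` (PROVED bookkeeping). -/
theorem mu_lowers_rational_raises_of_laws (h227 : HesseRationalKernelDifferentialLaw) (h228 : HesseMuKernelDifferentialLaw)
    {W W' W'' : WeierstrassCurve ℚ} [W.IsElliptic] [W.IsGloballyMinimal] [W'.IsElliptic] [W'.IsGloballyMinimal]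
    [W''.IsElliptic] [W''.IsGloballyMinimal] {L L' L'' : PeriodPair} {c : ℤ} (hL : IsNeronLatticeOf (W.baseChange ℂ) L)
    (hL' : IsNeronLatticeOf (W'.baseChange ℂ) L') (hL'' : IsNeronLatticeOf (W''.baseChange ℂ) L'') {X₀ Y₀ X₁ : ℚ} {a b : ℤ}
    (hT : IsShortThreeTorsion W c X₀ Y₀) (hμ : IsShortMuThreeAbscissa W c X₁)
    (hM : IsLatticeIsogenyWithKernelAbscissa L L' c a X₀) (hP : IsLatticeIsogenyWithKernelAbscissa L L'' c b X₁)
    (hK : ¬ IsIstarAtThree W) (hII : kodairaAtThree W ≠ .II) : a ^ 2 = 1 ∧ b ^ 2 = 9 := by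
  have hμ' : HasShortMuThree W c := (hasShortMuThree_iff_exists_abscissa W c).mpr ⟨X₁, hμ⟩
  refine ⟨(h227 W W' L L' c X₀ Y₀ a hL hL' hT hμ' hM).2 hK, (h228 W W'' L L'' c X₀ Y₀ X₁ b hL hL'' hT hμ hP).2 ?_⟩
  rintro (h | h)
  · exact hK h
  · exact hII h

/-- **The tame-additive FLIP (E-an-224 row `9 ∥ N`, PROVED from the laws):** at a Hesse curve of type `Iₙ*` the rational-kernel
quotient lowers (`a² = 9`) and the `μ₃`-quotient does not (`b² = 1`). -/
theorem rational_lowers_at_Istar_of_laws (h227 : HesseRationalKernelDifferentialLaw) (h228 : HesseMuKernelDifferentialLaw)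
    {W W' W'' : WeierstrassCurve ℚ} [W.IsElliptic] [W.IsGloballyMinimal] [W'.IsElliptic] [W'.IsGloballyMinimal]
    [W''.IsElliptic] [W''.IsGloballyMinimal] {L L' L'' : PeriodPair} {c : ℤ} (hL : IsNeronLatticeOf (W.baseChange ℂ) L)
    (hL' : IsNeronLatticeOf (W'.baseChange ℂ) L') (hL'' : IsNeronLatticeOf (W''.baseChange ℂ) L'') {X₀ Y₀ X₁ : ℚ} {a b : ℤ}
    (hT : IsShortThreeTorsion W c X₀ Y₀) (hμ : IsShortMuThreeAbscissa W c X₁)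
    (hM : IsLatticeIsogenyWithKernelAbscissa L L' c a X₀) (hP : IsLatticeIsogenyWithKernelAbscissa L L'' c b X₁)
    (hK : IsIstarAtThree W) : a ^ 2 = 9 ∧ b ^ 2 = 1 := by
  have hμ' : HasShortMuThree W c := (hasShortMuThree_iff_exists_abscissa W c).mpr ⟨X₁, hμ⟩
  exact ⟨(h227 W W' L L' c X₀ Y₀ a hL hL' hT hμ' hM).1 hK, (h228 W W'' L L'' c X₀ Y₀ X₁ b hL hL'' hT hμ hP).1 (Or.inl hK)⟩

/-- **Type II: nothing lowers (PROVED from the laws; the printed half of the wild rows).** -/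
theorem nothing_lowers_at_II_of_laws (h227 : HesseRationalKernelDifferentialLaw) (h228 : HesseMuKernelDifferentialLaw)
    {W W' W'' : WeierstrassCurve ℚ} [W.IsElliptic] [W.IsGloballyMinimal] [W'.IsElliptic] [W'.IsGloballyMinimal]
    [W''.IsElliptic] [W''.IsGloballyMinimal] {L L' L'' : PeriodPair} {c : ℤ} (hL : IsNeronLatticeOf (W.baseChange ℂ) L)
    (hL' : IsNeronLatticeOf (W'.baseChange ℂ) L') (hL'' : IsNeronLatticeOf (W''.baseChange ℂ) L'') {X₀ Y₀ X₁ : ℚ} {a b : ℤ}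
    (hT : IsShortThreeTorsion W c X₀ Y₀) (hμ : IsShortMuThreeAbscissa W c X₁)
    (hM : IsLatticeIsogenyWithKernelAbscissa L L' c a X₀) (hP : IsLatticeIsogenyWithKernelAbscissa L L'' c b X₁)
    (hK : kodairaAtThree W = .II) : a ^ 2 = 1 ∧ b ^ 2 = 1 := by
  have hμ' : HasShortMuThree W c := (hasShortMuThree_iff_exists_abscissa W c).mpr ⟨X₁, hμ⟩
  have hK' : ¬ IsIstarAtThree W := by rintro ⟨n, hn⟩; rw [hK] at hn; cases hn
  exact ⟨(h227 W W' L L' c X₀ Y₀ a hL hL' hT hμ' hM).2 hK',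
    (h228 W W'' L L'' c X₀ Y₀ X₁ b hL hL'' hT hμ hP).1 (Or.inr hK)⟩

end Summit.BirchSwinnertonDyer.Rank1Residual.ManinAdditive.HesseIsogenyDifferential

end
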